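import Mathlib
import Summits.Ventures.PercRepro2.Defs
import Summits.Ventures.PercRepro2.Graph
import Summits.Ventures.PercRepro2.Harris
import Summits.Ventures.PercRepro2.Events
import Summits.Ventures.PercRepro2.Independence
import Summits.Ventures.PercRepro2.Induced
import Summits.Ventures.PercRepro2.Exploration
import Summits.Ventures.PercRepro2.SideCluster
import Summits.Ventures.PercRepro2.CactusDefs
import Summits.Ventures.PercRepro2.CactusTriangle
import Summits.Ventures.PercRepro2.CactusTriangleMass
import Summits.Ventures.PercRepro2.CactusCluster

import Summits.Ventures.PercRepro2.CactusDel

/-!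
# The chain lemma on a triangular cactus: the components of a vertex outside two root clusters
are nested (blind cell PercRepro2, mine-c g11; proofs/MINEC-FEEDBACK.md §14)

Lens «induction on the conditioning set»: the revealed object is the root cluster `W = C(s)`,
and the potential is the COMPONENT `K_w(W)` of a fixed vertex `w ∉ W` in `G[F] − W`. On a
triangular cactus `F` built from the root, for any two root clusters `W₁, W₂` (of any two
configurations) the components `K_w(W₁)`, `K_w(W₂)` are NESTED: it is impossible that `w` reaches
`W₂` in `G[F] − W₁` and also reaches `W₁` in `G[F] − W₂` (`chain`). The proof is an induction along
the construction of the cactus through the pendant-excursion lemmas of `CactusDel.lean`. The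
probabilistic consequence (the hull-connection factor `P(t ↔ w in G ∖ W)` is log-supermodular on
root clusters when `G − t` is a triangular cactus) is drawn in `CactusGate.lean`.
-/

namespace Summit.Ventures.PercRepro2

namespace CactusChain

open Cactus

open scoped Classical

attribute [local instance 2000] Classical.propDecidable

variable {V : Type*} {E : Type*}

/-! ## The chain lemma -/

section Chain

variable {ends : E → Sym2 V} {s : V}

/-- **THE CHAIN LEMMA.** On a triangular cactus `F` built from the root `s`, for any two root
clusters `W₁ = C(s)(ω₁)`, `W₂ = C(s)(ω₂)` of `G[F]` and any vertex `w` outside both, it is impossible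
that `w` reaches `W₂` in `G[F] − W₁` and also reaches `W₁` in `G[F] − W₂`: the components of `w` in
`G[F] − W₁` and in `G[F] − W₂` are nested. (Induction along the construction of the cactus through
the excursion lemmas.) -/
theorem chain {F : Set E} (hF : IsCactusFrom ends s F) (w : V) (ω₁ ω₂ : Config E)
    (hw₁ : w ∉ clusterOn ends F ω₁ s) (hw₂ : w ∉ clusterOn ends F ω₂ s)
    (hr₁ : ∃ y ∈ clusterOn ends F ω₂ s, Conn ends (delCfg ends F (clusterOn ends F ω₁ s)) w y)
    (hr₂ : ∃ y ∈ clusterOn ends F ω₁ s, Conn ends (delCfg ends F (clusterOn ends F ω₂ s)) w y) :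
    False := by
  induction hF generalizing w with
  | empty =>
    rw [clusterOn_empty] at hw₁
    obtain ⟨y, hy, hc⟩ := hr₁
    rw [clusterOn_empty] at hy hc
    exact not_conn_delCfg_of_mem hw₁ hy hc
  | @edge F _ e x y he hxy hys hy heF ih =>
    have hsub : ∀ ω, clusterOn ends F ω s ⊆ clusterOn ends (insert e F) ω s :=
      fun ω v hv => (clusterOn_insert_edge he hxy hys hy ω v).2 (Or.inl hv)
    have hold : ∀ ω v, v ∈ clusterOn ends (insert e F) ω s → v ≠ y →
        v ∈ clusterOn ends F ω s := by
      intro ω v hv hvy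
      rcases (clusterOn_insert_edge he hxy hys hy ω v).1 hv with h | ⟨h, _⟩
      · exact h
      · exact (hvy h).elim
    have hnew : ∀ ω v, v ∈ clusterOn ends (insert e F) ω s → v = y →
        x ∈ clusterOn ends F ω s := by
      intro ω v hv hvy
      subst hvy
      rcases (clusterOn_insert_edge he hxy hys hy ω v).1 hv with h | ⟨_, h, _⟩
      · exact (y_notMem_clusterOn hys hy ω h).elim
      · exact h
    have hmono : ∀ ω, delCfg ends F (clusterOn ends (insert e F) ω s) ≤
        delCfg ends F (clusterOn ends F ω s) := fun ω => delCfg_anti F (hsub ω)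
    obtain ⟨y₂, hy₂, hc₂⟩ := hr₁
    obtain ⟨y₁, hy₁, hc₁⟩ := hr₂
    by_cases hwy : w = y
    · subst hwy
      rcases conn_insert_edge_of_new he hy hc₂ with hy₂y | ⟨hy₂y, hx₁, hcx₂⟩
      · exact hw₂ (by rw [← hy₂y]; exact hy₂)
      rcases conn_insert_edge_of_new he hy hc₁ with hy₁y | ⟨hy₁y, hx₂, hcx₁⟩
      · exact hw₁ (by rw [← hy₁y]; exact hy₁)
      refine ih x (fun h => hx₁ (hsub ω₁ h)) (fun h => hx₂ (hsub ω₂ h)) ?_ ?_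
      · exact ⟨y₂, hold ω₂ y₂ hy₂ hy₂y, conn_mono (hmono ω₁) hcx₂⟩
      · exact ⟨y₁, hold ω₁ y₁ hy₁ hy₁y, conn_mono (hmono ω₂) hcx₁⟩
    · refine ih w (fun h => hw₁ (hsub ω₁ h)) (fun h => hw₂ (hsub ω₂ h)) ?_ ?_
      · rcases conn_insert_edge_of_ne he hxy hy hwy hc₂ with ⟨hne, hc⟩ | ⟨hy₂y, hc⟩
        · exact ⟨y₂, hold ω₂ y₂ hy₂ hne, conn_mono (hmono ω₁) hc⟩
        · exact ⟨x, hnew ω₂ y₂ hy₂ hy₂y, conn_mono (hmono ω₁) hc⟩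
      · rcases conn_insert_edge_of_ne he hxy hy hwy hc₁ with ⟨hne, hc⟩ | ⟨hy₁y, hc⟩
        · exact ⟨y₁, hold ω₁ y₁ hy₁ hne, conn_mono (hmono ω₂) hc⟩
        · exact ⟨x, hnew ω₁ y₁ hy₁ hy₁y, conn_mono (hmono ω₂) hc⟩
  | @triangle F _ e₁ e₂ e₃ x y z h₁ h₂ h₃ hxy hxz hyz hys hzs hy hz h₁₂ h₁₃ h₂₃ hn₁ hn₂ hn₃ ih =>
    have hsub : ∀ ω, clusterOn ends F ω s ⊆
        clusterOn ends (insert e₁ (insert e₂ (insert e₃ F))) ω s :=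
      fun ω v hv =>
        (clusterOn_insert_triangle h₁ h₂ h₃ hxy hxz hyz hys hzs hy hz ω v).2 (Or.inl hv)
    have hold : ∀ ω v, v ∈ clusterOn ends (insert e₁ (insert e₂ (insert e₃ F))) ω s → v ≠ y →
        v ≠ z → v ∈ clusterOn ends F ω s := by
      intro ω v hv hvy hvz
      rcases (clusterOn_insert_triangle h₁ h₂ h₃ hxy hxz hyz hys hzs hy hz ω v).1 hv with
        h | ⟨h, _⟩ | ⟨h, _⟩
      · exact h
      · exact (hvy h).elim
      · exact (hvz h).elim
    have hnew : ∀ ω v, v ∈ clusterOn ends (insert e₁ (insert e₂ (insert e₃ F))) ω s →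
        (v = y ∨ v = z) → x ∈ clusterOn ends F ω s := by
      intro ω v hv hvyz
      rcases (clusterOn_insert_triangle h₁ h₂ h₃ hxy hxz hyz hys hzs hy hz ω v).1 hv with
        h | ⟨_, h, _⟩ | ⟨_, h, _⟩
      · rcases hvyz with hvy | hvz
        · subst hvy; exact (y_notMem_clusterOn hys hy ω h).elim
        · subst hvz; exact (y_notMem_clusterOn hzs hz ω h).elim
      · exact h
      · exact h
    have hmono : ∀ ω, delCfg ends F (clusterOn ends (insert e₁ (insert e₂ (insert e₃ F))) ω s) ≤
        delCfg ends F (clusterOn ends F ω s) := fun ω => delCfg_anti F (hsub ω)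
    obtain ⟨y₂, hy₂, hc₂⟩ := hr₁
    obtain ⟨y₁, hy₁, hc₁⟩ := hr₂
    by_cases hwyz : w = y ∨ w = z
    · rcases conn_insert_triangle_of_new h₁ h₂ h₃ hxy hxz hy hz hwyz hc₂ with
        hy₂yz | ⟨hy₂y, hy₂z, hx₁, hcx₂⟩
      · have hx₂ : x ∈ clusterOn ends F ω₂ s := hnew ω₂ y₂ hy₂ hy₂yz
        rcases conn_insert_triangle_of_new h₁ h₂ h₃ hxy hxz hy hz hwyz hc₁ with
          hy₁yz | ⟨_, _, hx₂', _⟩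
        · have hy₁w : y₁ ≠ w := fun h => hw₁ (by rw [← h]; exact hy₁)
          have hy₂w : y₂ ≠ w := fun h => hw₂ (by rw [← h]; exact hy₂)
          have hy₁y₂ : y₁ = y₂ := by
            rcases hwyz with hw | hw <;> rcases hy₁yz with h1 | h1 <;> rcases hy₂yz with h2 | h2 <;>
              first
              | exact h1.trans h2.symm
              | exact (hy₁w (h1.trans hw.symm)).elim
              | exact (hy₂w (h2.trans hw.symm)).elim
          exact not_conn_delCfg_of_mem hw₁ (by rw [← hy₁y₂]; exact hy₁) hc₂
        · exact hx₂' (hsub ω₂ hx₂)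
      · rcases conn_insert_triangle_of_new h₁ h₂ h₃ hxy hxz hy hz hwyz hc₁ with
          hy₁yz | ⟨hy₁y, hy₁z, hx₂, hcx₁⟩
        · exact hx₁ (hsub ω₁ (hnew ω₁ y₁ hy₁ hy₁yz))
        · refine ih x (fun h => hx₁ (hsub ω₁ h)) (fun h => hx₂ (hsub ω₂ h)) ?_ ?_
          · exact ⟨y₂, hold ω₂ y₂ hy₂ hy₂y hy₂z, conn_mono (hmono ω₁) hcx₂⟩
          · exact ⟨y₁, hold ω₁ y₁ hy₁ hy₁y hy₁z, conn_mono (hmono ω₂) hcx₁⟩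
    · have hwy : w ≠ y := fun h => hwyz (Or.inl h)
      have hwz : w ≠ z := fun h => hwyz (Or.inr h)
      refine ih w (fun h => hw₁ (hsub ω₁ h)) (fun h => hw₂ (hsub ω₂ h)) ?_ ?_
      · rcases conn_insert_triangle_of_ne h₁ h₂ h₃ hxy hxz hy hz hwy hwz hc₂ with
          ⟨hne₁, hne₂, hc⟩ | ⟨hyz', hc⟩
        · exact ⟨y₂, hold ω₂ y₂ hy₂ hne₁ hne₂, conn_mono (hmono ω₁) hc⟩
        · exact ⟨x, hnew ω₂ y₂ hy₂ hyz', conn_mono (hmono ω₁) hc⟩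
      · rcases conn_insert_triangle_of_ne h₁ h₂ h₃ hxy hxz hy hz hwy hwz hc₁ with
          ⟨hne₁, hne₂, hc⟩ | ⟨hyz', hc⟩
        · exact ⟨y₁, hold ω₁ y₁ hy₁ hne₁ hne₂, conn_mono (hmono ω₂) hc⟩
        · exact ⟨x, hnew ω₁ y₁ hy₁ hyz', conn_mono (hmono ω₂) hc⟩

end Chain

end CactusChain

end Summit.Ventures.PercRepro2
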